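import Literature.MathematicalPhysics.QuantumFieldTheory.Balaban1983to89.B16B10Shape

/-!
# `Balaban1983to89.B16TstarCount` — the bond count `|Ω₁*|` of [Balaban1988Convergent] (1.15) and the reader's
item `B16B10Shape.CountertermData.TstarCount`, DISCHARGED BY A KERNEL THEOREM

CITATION HEADER (lean-in-tree rule 2026-08-18).  Sources:
(B14 = [III]) T. Bałaban, *Convergent renormalization expansions for lattice gauge theories*, Commun. Math. Phys.
**119**, 243–285 (1988), doi:10.1007/bf01217741, bib `Balaban1988Convergent` (held:
`paper:balaban1988-cmp119-convergent-renormalization`; journal page = PDF page + 242);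
(B12 = [I]) T. Bałaban, *Renormalization group approach to lattice gauge field theories. I. Generation of effective
actions in a small field approximation and a coupling constant renormalization in four dimensions*, Commun. Math.
Phys. **109**, 249–301 (1987), doi:10.1007/bf01215223, bib `Balaban1987RG1` (held:
`paper:balaban1987-cmp109-rg-i-small-field`; journal page = PDF page + 248).  The quotations below were READ AS IMAGES
on the x2 page renders of the cell (`run/shared/lean/pub/pub-balaban/b2b-balaban-ref1/pages/`):
`1988-cmp119-convergent-renormalization-p007-x2.png` (p. 249), `1987-cmp109-rg-I-small-field-p003-x2.png` (p. 251),
`…-p004-x2.png` (p. 252), `…-p019-x2.png` (p. 267) — not on an OCR layer: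

* [III] p. 249 [7], after (1.14): *"Let us recall that the linearizing transformation is different from the identity
  only on bonds {b₀(c) : c ∈ Ω₁⁽¹⁾}, hence the characteristic function χ₀'(Ω₁), defined in (1.8), is unchanged under
  the transformation. The number |Ω₁*| is the number of bonds belonging to Ω₁ minus the number of bonds in the set
  {b₀(c) : c ∈ Ω₁⁽¹⁾}."* and, same page: *"we denote by A the integration variables restricted to bonds
  Ω₁* = Ω₁∖{b₀(c) : c ∈ Ω₁⁽¹⁾}."*; (1.15) carries the constants `+ log g₀ d(𝐠)|Ω₁*| + log σ₀|Ω₁*| − log z(L⁴ − 1)|Ω₁⁽¹⁾|`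
  in its first exponential (typed as the leaf `B16B10Shape.CountertermData.OneStep115`).
* [I] p. 267 [19], after (2.10): *"[Let us recall that for c ∈ T⁽ᵏ⁺¹⁾ the bond b₀(c) is defined as the bond of the
  lattice T⁽ᵏ⁾ contained in c and belonging to the corridor B(c) = {b ∈ T⁽ᵏ⁾ : b₋ ∈ B(c₋), b₊ ∈ B(c₊)}.]"*
  (print uses the SAME letter for the corridor B(c) of a coarse bond c and for the unit block B(y) of a coarse site y,
  (0.3) p. 252; in this file they are `corridor` and `blk` — revision v1.1, DOCFIX G-pv06-12: v1 had mis-transcribed the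
  corridor symbol with a tilde; docstring-only, every declaration byte-identical to v1.)
* [I] p. 251 [3]: *"Such a subset determines a set of lattice points, of a given scale, belonging to it, a set of
  bonds, i.e. intervals b connecting nearest neighbor points b₋, b₊, which intersect it, …"*; the torus:
  *"a torus T obtained by the usual identification of boundary points of the cube {x ∈ Rᵈ : −L_μ ≦ x_μ ≦ L_μ,
  μ = 1, …, d}. We take L_μ = Lᵐ, where L is an odd, positive integer > 11, and m is a positive integer."*;
  p. 252 [4], (0.3): `Bᵏ(y) = Δ(y) ∩ T…`, *"Δ(y) is a continuous space cube with a center at y and with the size …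
  Blocks of order 1 are denoted by B(y)."*

WHAT THIS MODULE DOES (audit cell `pub-balaban`, unit `b2b-balaban-pv24-g3` = SURGE NODE PROVER #24 gen 3, owner
lineage of `B16B10Shape` / `B16ZLower`; journal row TSTARCOUNT-KERNEL; value = a KERNEL CERTIFICATE of a reader's
item, NOT summit progress; nothing of the series is asserted).  `B16B10Shape.CountertermData.TstarCount` (§4 there) is
the READER'S COUNT *"|T⁽ʲ⁾*| = 4|T₁⁽ʲ⁾| − 4|T₁⁽ʲ⁺¹⁾|"* for Ω₁ = the whole 4-dimensional periodic lattice, entered there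
as a HYPOTHESIS (`hT`) of `negStep_lower` / `negE_lower` / `unitConfigLog_of_leaves` / `ep_lower_of_leaves`.  Here:

* §1 — ABSTRACT BLOCKED LATTICE.  Fine sites `Site`, coarse sites `CSite` (finite types), `d` directions; the
  (positively oriented) bonds are indexed `b = ⟨x, x + e_μ⟩ ↔ (x, μ)` (`Bond Site d := Site × Fin d`), so *"the number
  of bonds belonging to"* the whole lattice is `d·|sites|` (`card_bond`); a block map `blk : Site → CSite`
  (`x ∈ B(blk x)`); and a map `b0 : Bond CSite d → Bond Site d`.  Of the printed definition of `b₀(c)` ([I] p. 267)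
  exactly two consequences are used, recorded as `B0Spec blk b0`: `b₀(c)` is parallel to `c` (it is *"contained in
  c"*) and `b₀(c)₋ ∈ B(c₋)` (it is *"belonging to the corridor"*).  They make `b0` INJECTIVE (`B0Spec.injective`), hence
  `|{b₀(c) : c}| = d·|coarse sites|` (`card_image_b0`) and, for `Ω* := bonds ∖ {b₀(c) : c}` (`starBonds`),
  `|Ω*| = d·|sites| − d·|coarse sites|` (`card_starBonds`, `card_starBonds_real`; the literal *"number of bonds … minus
  the number of bonds in the set {b₀(c)}"* form is `card_bond_sub_card_image_real`; the sub-region form, for any set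
  of coarse bonds whose `b₀`-images lie in a bond set `Ω`, is `card_sdiff_image_eq`).
* §2 — THE CONCRETE PERIODIC LATTICE.  One coordinate: fine `ZMod n`, coarse `ZMod m`, `n = L·m`, blocks of `L`
  consecutive sites with an OFFSET `h < L` (`blkCoord L m h z = ⌊(z + h)/L⌋ mod m` on representatives in `[0, n[`;
  `h = 0` = corner blocks, `h = (L − 1)/2` with `L` odd = the CENTRED cubes of (0.3) [I] p. 252), the sublattice
  embedding `embCoord w = L·w`; `d` coordinates: sites `Fin d → ZMod n`, coarse sites `Fin d → ZMod m`, `blk`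
  componentwise; the coarse bond `c = ⟨y, y + e_μ⟩` consists of the `L` fine bonds `fineBond c i =
  ⟨L·y + i e_μ, L·y + (i + 1)e_μ⟩`, `i < L`, and `b0 c := fineBond c (L − 1 − h)`.  PROVED: `b0 c` is contained in `c`
  (`b0_containedIn`), lies in the corridor — `b₋ ∈ B(c₋)` and `b₊ ∈ B(c₊)` (`b0_mem_corridor`) — and is the ONLY one of
  the `L` bonds of `c` in the corridor as soon as the coarse torus has `m ≥ 2` sites per direction
  (`eq_b0_of_mem_corridor`): so `b0` IS the printed `b₀`, for every block offset; `B0Spec` holds (`b0Spec_torus`) and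
  `|Ω*| = d·nᵈ − d·mᵈ = d(Lᵈ − 1)mᵈ` (`card_starBonds_torus`, `card_starBonds_torus_real`).
* §3 — DICTIONARY.  For a `CountertermData S` whose `N j`, `N (j + 1)`, `Tstar j` ARE `|sites|`, `|coarse sites|`,
  `|Ω*|` of a blocked lattice with `d = 4` satisfying `B0Spec` at every scale `j < K`, the item holds: `S.TstarCount`
  (`tstarCount_of_blockedLattices`); in particular for the periodic lattices of §2 (`tstarCount_of_torus`, with the
  blocking identity `N (j + 1)·L⁴ = N j` for `j < K` thrown in: `blocking_of_torus`).  So the hypothesis `hT` of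
  `B16B10Shape.negE_lower` is a theorem of the lattice geometry, and — with `B16ZLower` — the only inputs of that bound
  which are neither located leaves nor kernel theorems are `EflBound` (author question (ii) of cell GAPS G-pv24-1) and
  the identification of the abstract carrier with the series' objects.

SCOPE, stated honestly.  The count is over the WHOLE periodic lattice `Ω₁ = T` (the case used in `B16B10Shape` §4,
where the small-field region is everything); for a general `Ω₁` only the injectivity statement `card_sdiff_image_eq`
is offered.  Bonds are indexed by (initial point, direction); on a torus with at least three sites per direction this
is the set of nearest-neighbour intervals of [I] p. 251 (for 1 or 2 sites per direction the interval picture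
degenerates, the indexing does not; the series' tori have `2L^{m+K−k} ≥ 2·13` sites per direction).  The block offset
`h` is a parameter: the series' blocks are the centred cubes (`L` odd, `h = (L − 1)/2`); the count does not depend on
`h` (§1 uses only `B0Spec`).  Nothing here touches a disputed step of the series: (1.15)'s `|Ω₁*|` and [I]'s `b₀(c)`
are definitions, and the count is reader's mathematics proved in the kernel.

ABSOLUTE RULE.  No internally-minted statement enters as a cited fact: every `theorem` below is kernel-proved from
Mathlib; the [cite] tags mark DEFINITIONS transcribing printed ones ((1.15) `Ω₁*`, [I] p. 267 `b₀`, (0.3) blocks);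
the papers' disputed steps are not used.  Companion: GAPS row C-pv24g3-1, journal CLAIMS.log `TSTARCOUNT-KERNEL`,
HANDOFF.md § b2b-balaban-pv24 gen 3.
-/

namespace Literature.MathematicalPhysics.QuantumFieldTheory.Balaban1983to89

namespace B16TstarCount

open Finset

/-! ## 1. Abstract blocked lattice: bonds = (site, direction); the printed `b₀` through its two used properties -/

section Abstract

/-- Positively oriented bonds of a lattice with site set `Site` and `d` directions, indexed `⟨x, x + e_μ⟩ ↔ (x, μ)`
([I] p. 251: *"bonds, i.e. intervals b connecting nearest neighbor points b₋, b₊"*). Reader's indexing. [folklore] -/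
abbrev Bond (Site : Type*) (d : ℕ) : Type _ := Site × Fin d

variable {Site CSite : Type*} {d : ℕ}

/-- *"the number of bonds belonging to"* the whole lattice: `d` per site. [folklore] -/
theorem card_bond [Fintype Site] : Fintype.card (Bond Site d) = d * Fintype.card Site := by
  simp only [Bond, Fintype.card_prod, Fintype.card_fin, mul_comm]

/-- The two consequences of the printed definition of `b₀` ([I] p. 267: *"the bond of the lattice T⁽ᵏ⁾ contained in c
and belonging to the corridor B(c) = {b ∈ T⁽ᵏ⁾ : b₋ ∈ B(c₋), b₊ ∈ B(c₊)}"*) that the count uses, over an abstract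
block map `blk` (`x ∈ B(blk x)`): `b₀(c)` has the direction of `c`, and its initial point lies in the block of the
initial point of `c`.  A hypothesis on `(blk, b0)`, discharged for the periodic lattice in §2 — a READER'S predicate
(this file's reading of [I] p. 267, not a printed statement). [folklore] -/
structure B0Spec (blk : Site → CSite) (b0 : Bond CSite d → Bond Site d) : Prop where
  /-- `b₀(c)` is parallel to `c` (it is contained in `c`). -/
  dir_eq : ∀ c, (b0 c).2 = c.2
  /-- `b₀(c)₋ ∈ B(c₋)`. -/
  start_mem : ∀ c, blk (b0 c).1 = c.1

variable {blk : Site → CSite} {b0 : Bond CSite d → Bond Site d}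

/-- `c ↦ b₀(c)` is injective: `c` is recovered as (block of `b₀(c)₋`, direction of `b₀(c)`). [folklore] -/
theorem B0Spec.injective (hb : B0Spec blk b0) : Function.Injective b0 := by
  intro c c' hcc
  have h1 := hb.start_mem c
  have h2 := hb.start_mem c'
  have h3 := hb.dir_eq c
  have h4 := hb.dir_eq c'
  rw [hcc] at h1 h3
  exact Prod.ext (h1.symm.trans h2) (h3.symm.trans h4)

variable [DecidableEq Site]

/-- For any finite set `C` of coarse bonds, `|{b₀(c) : c ∈ C}| = |C|`. [folklore] -/
theorem card_image_b0_eq (hb : B0Spec blk b0) (C : Finset (Bond CSite d)) : (C.image b0).card = C.card :=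
  card_image_of_injective _ hb.injective

/-- Sub-region form: if the images `b₀(c)`, `c ∈ C`, lie in a bond set `Ω`, then
`|Ω ∖ {b₀(c) : c ∈ C}| = |Ω| − |C|`. [folklore] -/
theorem card_sdiff_image_eq (hb : B0Spec blk b0) (Ω : Finset (Bond Site d)) (C : Finset (Bond CSite d))
    (hC : C.image b0 ⊆ Ω) : (Ω \ C.image b0).card = Ω.card - C.card := by
  rw [card_sdiff_of_subset hC, card_image_b0_eq hb]

variable [Fintype CSite]

/-- *"the number of bonds in the set {b₀(c) : c ∈ Ω₁⁽¹⁾}"* for Ω₁⁽¹⁾ = all coarse bonds: `d·|coarse sites|`. [folklore] -/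
theorem card_image_b0 (hb : B0Spec blk b0) :
    (univ.image b0).card = d * Fintype.card CSite := by
  rw [card_image_of_injective _ hb.injective, card_univ, card_bond]

variable [Fintype Site]

variable (b0) in
/-- [III] p. 249: `Ω₁* = Ω₁∖{b₀(c) : c ∈ Ω₁⁽¹⁾}` for Ω₁ = the whole lattice (all bonds, all coarse bonds).
[cite: Balaban1988Convergent, (1.15) p.249] -/
def starBonds : Finset (Bond Site d) := univ \ univ.image b0

/-- `|Ω*| + |{b₀(c)}| = |bonds|`. [folklore] -/
theorem card_starBonds_add : (starBonds b0).card + (univ.image b0).card = Fintype.card (Bond Site d) := by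
  rw [starBonds, card_sdiff_add_card_eq_card (subset_univ _), card_univ]

/-- **The count** (natural numbers): `|Ω*| = d·|sites| − d·|coarse sites|`. [folklore] -/
theorem card_starBonds (hb : B0Spec blk b0) :
    (starBonds b0).card = d * Fintype.card Site - d * Fintype.card CSite := by
  have h := card_starBonds_add (b0 := b0)
  rw [card_image_b0 hb, card_bond] at h
  omega

/-- **The count** (real numbers, the form used by `CountertermData`): `|Ω*| = d·|sites| − d·|coarse sites|`. [folklore] -/
theorem card_starBonds_real (hb : B0Spec blk b0) :
    ((starBonds b0).card : ℝ) = d * Fintype.card Site - d * Fintype.card CSite := by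
  have h := card_starBonds_add (b0 := b0)
  rw [card_image_b0 hb, card_bond] at h
  have h' : ((starBonds b0).card : ℝ) + (d * Fintype.card CSite : ℕ) = (d * Fintype.card Site : ℕ) := by
    exact_mod_cast h
  push_cast at h'
  linarith

/-- Literal form of [III] p. 249: *"the number of bonds belonging to Ω₁ minus the number of bonds in the set
{b₀(c) : c ∈ Ω₁⁽¹⁾}"* `= d·|sites| − d·|coarse sites|` (as real numbers). [folklore] -/
theorem card_bond_sub_card_image_real (hb : B0Spec blk b0) :
    (Fintype.card (Bond Site d) : ℝ) - ((univ.image b0).card : ℝ) = d * Fintype.card Site - d * Fintype.card CSite := by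
  rw [card_image_b0 hb, card_bond]
  push_cast
  ring

end Abstract

/-! ## 2. The periodic lattice `(ℤ/n)ᵈ`, `n = L·m`, with `L`-blocks of offset `h` and the explicit `b₀` -/

section Torus

variable {n m : ℕ}

/-- One coordinate of the block map: the fine coordinate `z ∈ ℤ/n` (representative in `[0, n[`) lies in the block of
the coarse coordinate `⌊(z + h)/L⌋ mod m`; `h = 0`: blocks `[Lw, Lw + L[`; `h = (L − 1)/2`, `L` odd: the centred blocks
`[Lw − h, Lw + h]` of (0.3) [I] p. 252. Reader's coordinates for a printed definition. [cite: Balaban1987RG1, (0.3) p.252] -/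
def blkCoord (L m h : ℕ) (z : ZMod n) : ZMod m := ((((z.val + h) / L : ℕ)) : ZMod m)

/-- One coordinate of the embedding of the coarse lattice as the sublattice `L·(ℤ/m) ⊂ ℤ/n` (block centres).
[folklore] -/
def embCoord (L n : ℕ) (w : ZMod m) : ZMod n := (((L * w.val : ℕ)) : ZMod n)

/-- `blkCoord` on a natural-number representative: `⌊((a mod n) + h)/L⌋ ≡ ⌊(a + h)/L⌋ (mod m)` when `n = L·m`.
[folklore] -/
theorem blkCoord_natCast (L h : ℕ) (hn : n = L * m) (hL : 0 < L) (a : ℕ) :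
    blkCoord L m h ((a : ZMod n)) = ((((a + h) / L : ℕ)) : ZMod m) := by
  unfold blkCoord
  rw [ZMod.val_natCast]
  subst hn
  set q := a / (L * m) with hq
  set r := a % (L * m) with hr
  have ha : a = L * (q * m) + r := by
    have := (Nat.div_add_mod a (L * m)).symm
    rw [← hq, ← hr] at this
    rw [this]
    ring
  have h1 : (a + h) / L = q * m + (r + h) / L := by
    rw [ha, add_assoc, Nat.mul_add_div hL]
  rw [h1, Nat.cast_add, Nat.cast_mul, ZMod.natCast_self, mul_zero, zero_add]

/-- The block coordinate of `L·w + i`: `w + ⌊(i + h)/L⌋`. [folklore] -/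
theorem blkCoord_embCoord_add [NeZero m] (L h : ℕ) (hn : n = L * m) (hL : 0 < L) (w : ZMod m) (i : ℕ) :
    blkCoord L m h (embCoord L n w + (i : ZMod n)) = w + ((((i + h) / L : ℕ)) : ZMod m) := by
  have h1 : embCoord L n w + (i : ZMod n) = (((L * w.val + i : ℕ)) : ZMod n) := by
    simp [embCoord]
  rw [h1, blkCoord_natCast L h hn hL, add_assoc, Nat.mul_add_div hL, Nat.cast_add, ZMod.natCast_zmod_val]

/-- Inside the block: `i + h < L` gives block `w`. [folklore] -/
theorem blkCoord_embCoord_add_of_lt [NeZero m] (L h : ℕ) (hn : n = L * m) (w : ZMod m) (i : ℕ)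
    (hi : i + h < L) : blkCoord L m h (embCoord L n w + (i : ZMod n)) = w := by
  have hL : 0 < L := by omega
  rw [blkCoord_embCoord_add L h hn hL, Nat.div_eq_of_lt hi, Nat.cast_zero, add_zero]

/-- Crossing into the next block: `i + h = L` gives block `w + 1`. [folklore] -/
theorem blkCoord_embCoord_add_of_eq [NeZero m] (L h : ℕ) (hn : n = L * m) (w : ZMod m) (i : ℕ)
    (hi : i + h = L) (hL : 0 < L) : blkCoord L m h (embCoord L n w + (i : ZMod n)) = w + 1 := by
  rw [blkCoord_embCoord_add L h hn hL, hi, Nat.div_self hL, Nat.cast_one]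

variable {d : ℕ}

/-- The block map of the `d`-dimensional periodic lattice `(ℤ/n)ᵈ → (ℤ/m)ᵈ`, componentwise `blkCoord`:
`x ∈ B(blk x)`. [cite: Balaban1987RG1, (0.3) p.252] -/
def blk (L m h : ℕ) (x : Fin d → ZMod n) : Fin d → ZMod m := fun ν => blkCoord L m h (x ν)

/-- The unit vector `e_μ` of the fine lattice. [folklore] -/
def fUnit (n : ℕ) (μ : Fin d) : Fin d → ZMod n := fun ν => if ν = μ then 1 else 0

/-- The unit vector `e_μ` of the coarse lattice. [folklore] -/
def cUnit (m : ℕ) (μ : Fin d) : Fin d → ZMod m := fun ν => if ν = μ then 1 else 0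

/-- The `i`-th of the `L` bonds of the fine lattice of which the coarse bond `c = ⟨y, y + e_μ⟩` (a straight segment
of `L` fine bonds) consists: `⟨L·y + i e_μ, L·y + (i + 1) e_μ⟩`, indexed `(L·y + i e_μ, μ)`. [folklore] -/
def fineBond (L n : ℕ) (c : Bond (Fin d → ZMod m) d) (i : ℕ) : Bond (Fin d → ZMod n) d :=
  (fun ν => embCoord L n (c.1 ν) + (if ν = c.2 then ((i : ℕ) : ZMod n) else 0), c.2)

/-- THE EXPLICIT `b₀(c)`: the bond of `c` with index `L − 1 − h` — the one crossing from the block of `c₋` into the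
block of `c₊` (`h = (L − 1)/2`: the middle bond of `c`). [cite: Balaban1987RG1, p.267] -/
def b0 (L n h : ℕ) (c : Bond (Fin d → ZMod m) d) : Bond (Fin d → ZMod n) d := fineBond L n c (L - 1 - h)

/-- A fine bond is *"contained in"* the coarse bond `c` iff it is one of its `L` constituent bonds. [folklore] -/
def ContainedIn (L n : ℕ) (b : Bond (Fin d → ZMod n) d) (c : Bond (Fin d → ZMod m) d) : Prop :=
  ∃ i, i < L ∧ b = fineBond L n c i

/-- The corridor of [I] p. 267: `B(c) = {b : b₋ ∈ B(c₋), b₊ ∈ B(c₊)}` (the inner `B(·)` = the unit block `blk`) with `b₋ = x`,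
`b₊ = x + e_μ` for `b = (x, μ)`
and `c₋ = y`, `c₊ = y + e_μ` for `c = (y, μ)`. [cite: Balaban1987RG1, p.267] -/
def corridor (L m h : ℕ) (c : Bond (Fin d → ZMod m) d) : Set (Bond (Fin d → ZMod n) d) :=
  {b | blk L m h b.1 = c.1 ∧ blk L m h (b.1 + fUnit n b.2) = c.1 + cUnit m c.2}

/-- `b₀(c)` is parallel to `c`. [folklore] -/
theorem b0_dir (L n h : ℕ) (c : Bond (Fin d → ZMod m) d) : (b0 L n h c).2 = c.2 := rfl

/-- `b₀(c)` is contained in `c` (needs `h < L`, i.e. a genuine offset). [folklore] -/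
theorem b0_containedIn (L n h : ℕ) (hh : h < L) (c : Bond (Fin d → ZMod m) d) : ContainedIn L n (b0 L n h c) c :=
  ⟨L - 1 - h, by omega, rfl⟩

variable [NeZero m]

/-- Every constituent bond of `c` with index `i`, `i + h < L`, STARTS in `B(c₋)`. [folklore] -/
theorem blk_fineBond_start (L h : ℕ) (hn : n = L * m) (c : Bond (Fin d → ZMod m) d) (i : ℕ) (hi : i + h < L) :
    blk L m h (fineBond L n c i).1 = c.1 := by
  funext ν
  simp only [blk, fineBond]
  by_cases hν : ν = c.2
  · rw [if_pos hν]
    exact blkCoord_embCoord_add_of_lt L h hn (c.1 ν) i hi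
  · rw [if_neg hν]
    have h0 := blkCoord_embCoord_add_of_lt L h hn (c.1 ν) 0 (by omega)
    rw [Nat.cast_zero] at h0
    exact h0

/-- The constituent bond of `c` with index `i`, `i + 1 + h = L`, ENDS in `B(c₊)`. [folklore] -/
theorem blk_fineBond_end (L h : ℕ) (hn : n = L * m) (c : Bond (Fin d → ZMod m) d) (i : ℕ) (hi : i + 1 + h = L) :
    blk L m h ((fineBond L n c i).1 + fUnit n c.2) = c.1 + cUnit m c.2 := by
  have hL : 0 < L := by omega
  funext ν
  simp only [blk, fineBond, fUnit, cUnit, Pi.add_apply]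
  by_cases hν : ν = c.2
  · rw [if_pos hν, if_pos hν, if_pos hν, add_assoc]
    have h1 : ((i : ℕ) : ZMod n) + 1 = (((i + 1 : ℕ)) : ZMod n) := by push_cast; ring
    rw [h1]
    exact blkCoord_embCoord_add_of_eq L h hn (c.1 ν) (i + 1) hi hL
  · rw [if_neg hν, if_neg hν, if_neg hν]
    simp only [add_zero]
    have h0 := blkCoord_embCoord_add_of_lt L h hn (c.1 ν) 0 (by omega)
    rw [Nat.cast_zero, add_zero] at h0
    exact h0

/-- `b₀(c)₋ ∈ B(c₋)`. [folklore] -/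
theorem blk_b0_start (L h : ℕ) (hn : n = L * m) (hh : h < L) (c : Bond (Fin d → ZMod m) d) :
    blk L m h (b0 L n h c).1 = c.1 :=
  blk_fineBond_start L h hn c (L - 1 - h) (by omega)

/-- `b₀(c)₊ ∈ B(c₊)`. [folklore] -/
theorem blk_b0_end (L h : ℕ) (hn : n = L * m) (hh : h < L) (c : Bond (Fin d → ZMod m) d) :
    blk L m h ((b0 L n h c).1 + fUnit n c.2) = c.1 + cUnit m c.2 :=
  blk_fineBond_end L h hn c (L - 1 - h) (by omega)

/-- `b₀(c)` belongs to the corridor `B(c)`. [folklore] -/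
theorem b0_mem_corridor (L h : ℕ) (hn : n = L * m) (hh : h < L) (c : Bond (Fin d → ZMod m) d) :
    b0 L n h c ∈ corridor (n := n) L m h c :=
  ⟨blk_b0_start L h hn hh c, blk_b0_end L h hn hh c⟩

/-- WELL-DEFINEDNESS OF THE PRINTED `b₀`: if the coarse lattice has at least two sites per direction (`m ≥ 2`), the
ONLY bond contained in `c` and belonging to the corridor is `b0 c`. [folklore] -/
theorem eq_b0_of_mem_corridor (L h : ℕ) (hn : n = L * m) (hh : h < L) (hm : 1 < m) (c : Bond (Fin d → ZMod m) d)
    (b : Bond (Fin d → ZMod n) d) (hb : ContainedIn L n b c) (hcorr : b ∈ corridor (n := n) L m h c) :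
    b = b0 L n h c := by
  obtain ⟨i, hi, rfl⟩ := hb
  have hL : 0 < L := by omega
  haveI : Fact (1 < m) := ⟨hm⟩
  have hone : (1 : ZMod m) ≠ 0 := by
    intro h10
    have := ZMod.val_one m
    rw [h10, ZMod.val_zero] at this
    exact absurd this (by norm_num)
  obtain ⟨hs, he⟩ := hcorr
  -- the `μ`-components of the two corridor conditions
  have hsμ := congrFun hs c.2
  have heμ := congrFun he c.2
  simp only [blk, fineBond, fUnit, cUnit, Pi.add_apply, ↓reduceIte] at hsμ heμ
  rw [blkCoord_embCoord_add L h hn hL] at hsμ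
  have h1 : ((i : ℕ) : ZMod n) + 1 = (((i + 1 : ℕ)) : ZMod n) := by push_cast; ring
  rw [add_assoc, h1, blkCoord_embCoord_add L h hn hL] at heμ
  -- start condition ⇒ `i + h < L`
  have hlt : i + h < L := by
    by_contra hge
    have hq : (i + h) / L = 1 :=
      Nat.div_eq_of_lt_le (by omega) (by omega)
    rw [hq, Nat.cast_one] at hsμ
    exact hone (by linear_combination hsμ)
  -- end condition ⇒ `L ≤ i + 1 + h`
  have hge : L ≤ i + 1 + h := by
    by_contra hlt'
    have hq : (i + 1 + h) / L = 0 := Nat.div_eq_of_lt (by omega)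
    rw [hq, Nat.cast_zero] at heμ
    exact hone (by linear_combination -heμ)
  have hi' : i = L - 1 - h := by omega
  subst hi'
  rfl

/-- The explicit `b₀` satisfies `B0Spec` for the block map `blk` (every offset `h < L`). [folklore] -/
theorem b0Spec_torus (L h : ℕ) (hn : n = L * m) (hh : h < L) :
    B0Spec (blk (d := d) (n := n) L m h) (b0 (d := d) (m := m) L n h) :=
  ⟨fun c => b0_dir L n h c, fun c => blk_b0_start L h hn hh c⟩

/-- `|(ℤ/n)ᵈ| = nᵈ`. [folklore] -/
theorem card_lattice (d n : ℕ) [NeZero n] : Fintype.card (Fin d → ZMod n) = n ^ d := by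
  rw [Fintype.card_fun, ZMod.card, Fintype.card_fin]

/-- **The count on the periodic lattice**: `|Ω*| = d·nᵈ − d·mᵈ` (`n = L·m`, any offset `h < L`). [folklore] -/
theorem card_starBonds_torus [NeZero n] (L h : ℕ) (hn : n = L * m) (hh : h < L) :
    (starBonds (b0 (d := d) (m := m) L n h)).card = d * n ^ d - d * m ^ d := by
  rw [card_starBonds (b0Spec_torus L h hn hh), card_lattice, card_lattice]

/-- Real form: `|Ω*| = d·nᵈ − d·mᵈ`. [folklore] -/
theorem card_starBonds_torus_real [NeZero n] (L h : ℕ) (hn : n = L * m) (hh : h < L) :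
    ((starBonds (b0 (d := d) (m := m) L n h)).card : ℝ) = d * (n : ℝ) ^ d - d * (m : ℝ) ^ d := by
  rw [card_starBonds_real (b0Spec_torus L h hn hh), card_lattice, card_lattice]
  push_cast
  ring

/-- Blocking: `nᵈ = Lᵈ·mᵈ`, so `|Ω*| = d(Lᵈ − 1)·mᵈ`. [folklore] -/
theorem card_starBonds_torus_real' [NeZero n] (L h : ℕ) (hn : n = L * m) (hh : h < L) :
    ((starBonds (b0 (d := d) (m := m) L n h)).card : ℝ) = d * ((L : ℝ) ^ d - 1) * (m : ℝ) ^ d := by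
  rw [card_starBonds_torus_real L h hn hh, hn]
  push_cast
  ring

/-- Numerical instance: `d = 4`, `L = 2`, one coarse site per direction (`m = 1`, `n = 2`): `|Ω*| = 4·16 − 4 = 60`.
[folklore] -/
example : (starBonds (b0 (d := 4) (m := 1) 2 2 0)).card = 60 := by
  have h := card_starBonds_torus (d := 4) (m := 1) (n := 2) 2 0 (by norm_num) (by norm_num)
  norm_num at h
  exact h

end Torus

/-! ## 3. Dictionary: the reader's item `CountertermData.TstarCount` as a theorem of the lattice geometry -/

section Dictionary

open B16B10Shape

/-- **`TstarCount` discharged (abstract form).**  If at every scale `j < K` the numbers `N j`, `N (j + 1)`, `Tstar j`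
of `S` ARE the site number, the coarse-site number and `|Ω*| = |bonds ∖ {b₀(c) : c}|` of a 4-dimensional blocked
lattice whose `b₀` satisfies `B0Spec` (direction of `c`, initial point in `B(c₋)` — [I] p. 267), then
`Tstar j = 4·N j − 4·N (j + 1)`, i.e. `S.TstarCount`. [folklore] -/
theorem tstarCount_of_blockedLattices (S : CountertermData)
    (Site : ℕ → Type*) (CSite : ℕ → Type*) [∀ j, Fintype (Site j)] [∀ j, Fintype (CSite j)]
    [∀ j, DecidableEq (Site j)]
    (blk : ∀ j, Site j → CSite j) (b0 : ∀ j, Bond (CSite j) 4 → Bond (Site j) 4)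
    (hb0 : ∀ j, j < S.K → B0Spec (blk j) (b0 j))
    (hN : ∀ j, j < S.K → S.N j = Fintype.card (Site j))
    (hN' : ∀ j, j < S.K → S.N (j + 1) = Fintype.card (CSite j))
    (hT : ∀ j, j < S.K → S.Tstar j = ((starBonds (b0 j)).card : ℝ)) :
    S.TstarCount := by
  intro j hj
  rw [hT j hj, card_starBonds_real (hb0 j hj), hN j hj, hN' j hj]
  push_cast
  ring

/-- **`TstarCount` discharged (periodic lattices).**  At scale `j < K` let T⁽ʲ⁾ be the periodic lattice
`(ℤ/n_j)⁴` with `n_j = L·m_j`, T⁽ʲ⁺¹⁾ `= (ℤ/m_j)⁴` its lattice of `L`-blocks (offset `h < L`; the series: `L` odd,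
`h = (L − 1)/2`), `N j = n_j⁴`, `N (j + 1) = m_j⁴` and `Tstar j = |Ω*|` for the explicit `b₀` of §2.  Then
`S.TstarCount`. [folklore] -/
theorem tstarCount_of_torus (S : CountertermData) (nn mm : ℕ → ℕ) (h : ℕ)
    [∀ j, NeZero (nn j)] [∀ j, NeZero (mm j)]
    (hn : ∀ j, j < S.K → nn j = S.L * mm j) (hh : h < S.L)
    (hN : ∀ j, j < S.K → S.N j = (((nn j) ^ 4 : ℕ) : ℝ))
    (hN' : ∀ j, j < S.K → S.N (j + 1) = (((mm j) ^ 4 : ℕ) : ℝ))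
    (hT : ∀ j, j < S.K →
      S.Tstar j = ((starBonds (b0 (d := 4) (m := mm j) S.L (nn j) h)).card : ℝ)) :
    S.TstarCount := by
  intro j hj
  rw [hT j hj, card_starBonds_torus_real (d := 4) S.L h (hn j hj) hh, hN j hj, hN' j hj]
  push_cast
  ring

/-- In the same setting the blocking identity `N (j + 1)·L⁴ = N j` holds at every `j < K` (cf. the leaf
`CountertermData.Blocking`, which asks it for all `j`). [folklore] -/
theorem blocking_of_torus (S : CountertermData) (nn mm : ℕ → ℕ)
    (hn : ∀ j, j < S.K → nn j = S.L * mm j)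
    (hN : ∀ j, j < S.K → S.N j = (((nn j) ^ 4 : ℕ) : ℝ))
    (hN' : ∀ j, j < S.K → S.N (j + 1) = (((mm j) ^ 4 : ℕ) : ℝ)) :
    ∀ j, j < S.K → S.N (j + 1) * (S.L : ℝ) ^ 4 = S.N j := by
  intro j hj
  rw [hN j hj, hN' j hj, hn j hj]
  push_cast
  ring

end Dictionary

end B16TstarCount

end Literature.MathematicalPhysics.QuantumFieldTheory.Balaban1983to89
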